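import Literature.Probability.RandomPlanarGeometry.SAWPolygonJoinMap
import Literature.Probability.RandomPlanarGeometry.SAWPolygonJoinCap
import Literature.Probability.RandomPlanarGeometry.SAWTallPolygons
import Literature.Probability.RandomPlanarGeometry.SAWPolygonDoublingBootstrap

/-!
# Madras' bound `p_n ≤ A n^{-1/2} μ^n` for self-avoiding polygons of `ℤ²`, with the explicit constant `A = 2 μ¹⁶`

Topic `Literature/Probability/RandomPlanarGeometry` (assembles `SAWPolygonJoinSpec.lean` (statements), `SAWTallPolygons.lean`
(S1: tall polygons), `SAWPolygonJoinCap.lean` (S2: the cap gadget), `SAWPolygonJoinParity.lean` (S3⁺: the unique interior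
equal-split neck), `SAWPolygonJoinMap.lean` (S4+S5: the join map and `√n·p_n² ≤ 2·p_{2n+16}`) and
`SAWPolygonDoublingBootstrap.lean` (S6: the doubling bootstrap, `p_{2n}^{1/2n} → μ`)).

Source.  N. Madras, *A rigorous bound on the critical exponent for the number of lattice trees, animals, and polygons*,
J. Stat. Phys. 78 (1995) 681–699 [Madras1995LatticeAnimalsExponent]: for `d = 2` there is a constant `A` with
`p_n ≤ A n^{-1/2} μ^n` for all (even) `n`, `p_n` the number of `n`-step self-avoiding polygons up to translation and `μ` the
connective constant — as quoted by A. Hammond, arXiv:1504.05286 [Hammond2015SAPJoining], §2 p. 4 (arXiv v5, 2017):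
"he has shown in [Madras95]
using a polygon joining technique that `θ_n ≥ 1/2 − o(1)` for `d = 2`" (`p_n = n^{-θ_n} μ^n`).  Here the constant is explicit,
`A = 2 μ¹⁶` (sixteen surgery edges, multiplicity one), from the lane's route MAD95-2JP (venture «pcv-sawmu»; blueprint a-idea-2,
proofs a-p1/a-p2/a-p3): `p_m ≤ 2 μ¹⁶ (m+16)^{-1/2} μ^m ≤ 2 μ¹⁶ m^{-1/2} μ^m` for every even `m ≥ 4`.

## Contents (namespace `Literature.Probability.RandomPlanarGeometry.SAW.JoinParity`; 0 sorries)

* discharges of the statement-Props of `SAWPolygonJoinSpec.lean`: `polygonLimit`, `bootstrap2` (from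
  `SAWPolygonDoublingBootstrap`); S1a/S1b are `SAWTallPolygons.lean`'s `SAW.card_normPolygons_le_two_mul_card_filter_isTall` /
  `SAW.exists_height_sq_ge_of_isTall` (its `SAW.IsTall` is definitionally `JoinParity.IsTall`), `capGadget` is
  `SAWPolygonJoinCap.lean`'s, `uniqueInteriorEqNeck` is `SAWPolygonJoinParity.lean`'s, `counting2` is `SAWPolygonJoinMap.lean`'s;
* **`joinIneq2 : JoinIneq2`** — `√n · p_n² ≤ 2 · p_{2n+16}` for every even `n ≥ 4`;
* **`mad95_explicit2 : MAD95_Explicit2`** and the unfolded forms **`madras1995_polygonBound_explicit`**,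
  **`madras1995_polygonBound`** (`∃ A > 0, ∀ even m ≥ 4, p_m ≤ A m^{-1/2} μ^m`).
-/

noncomputable section

open Filter Topology Finset SimpleGraph Literature.Probability.LatticeModels Literature.Probability.Percolation
open Literature.Probability.RandomPlanarGeometry.SAW

namespace Literature.Probability.RandomPlanarGeometry.SAW.JoinParity

/-- **`PolygonLimit` holds**: `p_{2n}^{1/2n} → μ`. [cite: MadrasSlade1993, §3.2 eq. (3.2.9)] -/
theorem polygonLimit : PolygonLimit := SAW.polygonLimit

/-- **S6 holds**: the doubling bootstrap. [cite: Madras1995LatticeAnimalsExponent, §2 (the a-priori bound from the superadditivity-type inequality)] -/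
theorem bootstrap2 : Bootstrap2 := SAW.bootstrap2

/-- **The join inequality with the `√n` gain**: `√n · p_n² ≤ 2 · p_{2n+16}` for every even `n ≥ 4` — Madras' counting
("at least an order of `n^ν` locations to which `φ'` may be translated and then attached to `φ`", `ν = 1/2`) with an
injective join (multiplicity one, by the unique interior equal-split neck).
[cite: Madras1995LatticeAnimalsExponent, §2; Hammond2015SAPJoining, §3.4, Step one, eq. (3.6) p. 12, with ν = 1/2 (arXiv v5)] -/
theorem joinIneq2 : JoinIneq2 :=
  joinIneq2_of SAW.card_normPolygons_le_two_mul_card_filter_isTall SAW.exists_height_sq_ge_of_isTall capGadget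

/-- **Madras' polygon bound with an explicit constant (`MAD95_Explicit2`)**: `p_m ≤ 2 μ¹⁶ (m+16)^{-1/2} μ^m` for every even
`m ≥ 4`. [cite: Madras1995LatticeAnimalsExponent, §1 (p_n ≤ A n^{-1/2} μ^n, d = 2); Hammond2015SAPJoining, §2 p. 4 (arXiv v5)] -/
theorem mad95_explicit2 : MAD95_Explicit2 :=
  mad95_explicit2_of SAW.card_normPolygons_le_two_mul_card_filter_isTall SAW.exists_height_sq_ge_of_isTall capGadget
    uniqueInteriorEqNeck counting2 bootstrap2 polygonLimit

/-- **Madras (1995), `d = 2`, explicit form**: for every even `m ≥ 4`,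
`#SAP_m ≤ 2 μ¹⁶ · (m+16)^{-1/2} · μ^m`, `μ = μ(ℤ²)` the connective constant, `SAP_m = normPolygons m` the `m`-step
self-avoiding polygons up to translation. [cite: Madras1995LatticeAnimalsExponent, §1 (p_n ≤ A n^{-1/2} μ^n, d = 2); Hammond2015SAPJoining, §2 p. 4 (arXiv v5)] -/
theorem madras1995_polygonBound_explicit (m : ℕ) (hm : Even m) (h4 : 4 ≤ m) :
    ((normPolygons m).card : ℝ) ≤
      2 * Zd.connectiveConstant 2 ^ 16 * (((m : ℝ) + 16) ^ (-(1 / 2 : ℝ))) * Zd.connectiveConstant 2 ^ m :=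
  mad95_explicit2 m hm h4

/-- **Madras (1995), `d = 2`, AS PRINTED**: "`p_n ≤ A n^{-1/2} μ^n`" — there is `A > 0` (here `A = 2 μ¹⁶`) with
`#SAP_m ≤ A · m^{-1/2} · μ^m` for every even `m ≥ 4`.
[cite: Madras1995LatticeAnimalsExponent, §1 (Theorem: p_n ≤ A n^{-1/2} μ^n in two dimensions); Hammond2015SAPJoining, §2 p. 4 ("θ_n ≥ 1/2 − o(1) for d = 2"; arXiv v5)] -/
theorem madras1995_polygonBound :
    ∃ A : ℝ, 0 < A ∧ ∀ m : ℕ, Even m → 4 ≤ m →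
      ((normPolygons m).card : ℝ) ≤ A * ((m : ℝ) ^ (-(1 / 2 : ℝ))) * Zd.connectiveConstant 2 ^ m :=
  exists_A_of_explicit2 mad95_explicit2

/-! ### Exact-name discharges `<Fact>_holds` of the MAD95-2JP statement-`Prop`s

The statement-`Prop`s of `SAWPolygonJoinParity.lean` (S3: `RayParityVert`, …, `UniqueInteriorEqNeck`) and of
`SAWPolygonJoinSpec.lean` (S4–S6 and the target: `JoinIneq2`, `PolygonLimit`, `MAD95_Explicit2`, `Bootstrap2`) are all PROVED
in the tree, under lower-camel-case names (`rayParityVert`, …, `joinIneq2`, `mad95_explicit2`).  The tree's named-fact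
accounting keys on the exact name `<Fact>_holds`; the aliases below are those discharges (same proofs, no new statements).
(S1a/S1b `TallHalf`/`TallHeight`, S2 `CapGadget` and `Counting2` are discharged by `tallHalf`/`tallHeight`
(`SAWPolygonTall.lean`), `capGadget` (`SAWPolygonJoinCap.lean`), `counting2` (`SAWPolygonJoinMap.lean`); their exact-name
aliases belong in those modules.) -/

/-- `RayParityVert` (D1v: the vertical step `c ↦ c + ey` flips the upward ray parity iff the crossed horizontal edge
`plaqTop c` lies in `E`), discharged: `rayParityVert`.
[cite: Madras1995LatticeAnimalsExponent, §2 (joining polygons across a plaquette; supporting lemma for the explicit form)] -/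
theorem RayParityVert_holds : RayParityVert := rayParityVert

/-- `RayParityHoriz` (D1h: for a polygon `E`, the horizontal step `c ↦ c + ex` flips the upward ray parity iff the crossed
vertical edge `plaqRight c` lies in `E`), discharged: `rayParityHoriz`.
[cite: Madras1995LatticeAnimalsExponent, §2 (joining polygons across a plaquette; supporting lemma for the explicit form)] -/
theorem RayParityHoriz_holds : RayParityHoriz := rayParityHoriz

/-- `TransportAlong` (transport: all cells with a side on a polygon `F` vertex-disjoint from the polygon `E` have the same
`E`-parity), discharged: `transportAlong`.
[cite: Madras1995LatticeAnimalsExponent, §2 (joining polygons across a plaquette; supporting lemma for the explicit form)] -/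
theorem TransportAlong_holds : TransportAlong := transportAlong

/-- `FlipParityIdentity` (L1: `π_{E₁}(c) + π_{E₂}(c) = π_E(c) + [c = v]` when `E Δ P(v) = E₁ ⊔ E₂`), discharged:
`flipParityIdentity`.
[cite: Madras1995LatticeAnimalsExponent, §2 (joining polygons across a plaquette; supporting lemma for the explicit form)] -/
theorem FlipParityIdentity_holds : FlipParityIdentity := flipParityIdentity

/-- `SidesSplit` (L2′: a polygon inside `E Δ P(v)` contains a vertical side of `P(v)`), discharged: `sidesSplit`.
[cite: Madras1995LatticeAnimalsExponent, §2 (joining polygons across a plaquette; supporting lemma for the explicit form)] -/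
theorem SidesSplit_holds : SidesSplit := sidesSplit

/-- `Interleave` (L3: if `P(v)` is an equal-split join plaquette of `E` with pieces `E₁, E₂` and `P(v')`, `v' ≠ v`, is
another one, then each piece contains a horizontal side of `P(v')`), discharged: `interleave`.
[cite: Madras1995LatticeAnimalsExponent, §2 (joining polygons across a plaquette; supporting lemma for the explicit form)] -/
theorem Interleave_holds : Interleave := interleave

/-- `EqJoinParityDistinct` (S3 core: two distinct equal-split join plaquettes of a lattice polygon have different upward
ray parities), discharged: `eqJoinParityDistinct`. [cite: Madras1995LatticeAnimalsExponent, §2 (joining polygons across a plaquette; supporting lemma for the explicit form)] -/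
theorem EqJoinParityDistinct_holds : EqJoinParityDistinct := eqJoinParityDistinct

/-- **S3, the «2JP lemma»** `AtMostTwoEqJoinPlaquettes` (a self-avoiding polygon of `ℤ²` has at most two equal-split join
plaquettes), discharged: `atMostTwoEqJoinPlaquettes`. [cite: Madras1995LatticeAnimalsExponent, §2 (joining polygons across a plaquette; supporting lemma for the explicit form)] -/
theorem AtMostTwoEqJoinPlaquettes_holds : AtMostTwoEqJoinPlaquettes := atMostTwoEqJoinPlaquettes

/-- **S3⁺** `UniqueInteriorEqNeck` (a lattice polygon has at most one equal-split join plaquette of odd upward ray parity,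
i.e. lying inside the polygon), discharged: `uniqueInteriorEqNeck`.
[cite: Madras1995LatticeAnimalsExponent, §2 (joining polygons across a plaquette; supporting lemma for the explicit form)] -/
theorem UniqueInteriorEqNeck_holds : UniqueInteriorEqNeck := uniqueInteriorEqNeck

/-- **S4+S5** `JoinIneq2` (`√n · p_n² ≤ 2 · p_{2n+16}` for every even `n ≥ 4`), discharged: `joinIneq2`.
[cite: Madras1995LatticeAnimalsExponent, §2; Hammond2015SAPJoining, §3.4, Step one, eq. (3.6) with ν = 1/2, pp. 12–13 (Madras' counting; arXiv v5)] -/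
theorem JoinIneq2_holds : JoinIneq2 := joinIneq2

/-- `PolygonLimit` (`p_{2n}^{1/2n} → μ`), discharged: `polygonLimit` (`SAWPolygonDoublingBootstrap.lean`).
[cite: MadrasSlade1993, §3.2 eq. (3.2.9)] -/
theorem PolygonLimit_holds : PolygonLimit := polygonLimit

/-- **Madras' polygon bound with the explicit constant** `MAD95_Explicit2` (`p_m ≤ 2 μ¹⁶ (m+16)^{-1/2} μ^m`, even `m ≥ 4`),
discharged: `mad95_explicit2`. [cite: Madras1995LatticeAnimalsExponent, §1 (p_n ≤ A n^{-1/2} μ^n in d = 2); Hammond2015SAPJoining, §2 p. 4 (arXiv v5)] -/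
theorem MAD95_Explicit2_holds : MAD95_Explicit2 := mad95_explicit2

/-- **S6** `Bootstrap2` (the doubling bootstrap: join inequality + polygon limit ⇒ the explicit bound), discharged:
`bootstrap2` (`SAWPolygonDoublingBootstrap.lean`). [cite: Madras1995LatticeAnimalsExponent, §2 (the a-priori bound from the superadditivity-type inequality)] -/
theorem Bootstrap2_holds : Bootstrap2 := bootstrap2

end Literature.Probability.RandomPlanarGeometry.SAW.JoinParity
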